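import Mathlib
import Summits.ResolutionOfSingularities.ResolutionOfSingularities.Theorems.RadicialJungCleanModelsPointChainCleanSeq
import Summits.ResolutionOfSingularities.ResolutionOfSingularities.Theorems.RadicialJungCleanModelsL7bGlobal
import Summits.ResolutionOfSingularities.ResolutionOfSingularities.Theorems.RadicialJungCleanModelsContactChainL7bX44c
import HarnessLib

/-!
# Route `RadicialJung`, crux `CleanModels` (stmt-ResolutionOfSingularities-15917), line `Sketch` rev 35, stub 6 `stub_cleanProp44` (X44c),
# work plan O8 recorded for O6: L7b-GLOBAL as an EXTENSION OF THE CLEAN-PERMISSIBLE COSSART–PILTANT SEQUENCE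

Memo `Cruxes/CleanModels/Lines/Sketch-memo-hand2-g10-stubs-5-7.md` §3/§4 (i).  ✓ `exists_proper_isIso_forall_cleanPermissibleAt` (`…L7bGlobal.lean`) recorded
its composite of point-blow-up chains only as «proper, iso off the bad points».  Here the same induction on the number of bad points is re-run
CARRYING the predicate of `stub_cleanProp44`: if `ρ : X → S` is a clean-permissible Cossart–Piltant sequence for `(J, G₀)`
(`IsCleanRegularCentreBlowupSeq p ρ J G₀`; `S` with `char K(S) = p`, the line of `G₀` clean-regular everywhere on `S`), `X` regular locally Noetherian
quasi-excellent, and `C₀ = cl{η} ⊆ X` a one-dimensional regular curve INSIDE THE NON-LOCALLY-PRINCIPAL LOCUS of `J𝒪_X` with finitely many bad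
points for the line of `ρ^♯ G₀`, then there are `σ : X' → X` with `σ ≫ ρ` AGAIN a clean-permissible Cossart–Piltant sequence for `(J, G₀)`
(✓ `IsPointChainAlong.isCleanRegularCentreBlowupSeq` at each step), `X'` regular quasi-excellent, and the strict transform `C = cl{η'} ⊆ X'`
(`σ η' = η`) a regular curve inside the non-locally-principal locus of `J𝒪_{X'}` at EVERY point of which the line of `σ^♯ ρ^♯ G₀` is clean-permissible
— i.e. exactly the hypotheses of `IsCleanRegularCentreBlowupSeq.cons` for blowing up `C` next (`exists_isCleanRegularCentreBlowupSeq_forall_cleanPermissibleAt`;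
on the stages of `stub_cleanProp44` the finiteness is automatic: `…_of_stage`).

Honest framing: OURS; this closes the O8/O6 junction of the X44c work plan up to the NOETHERIAN-ness / integrality bookkeeping of `C` as a centre
(`IsCleanRegularCentreBlowupSeq.cons` wants `IsIntegral` and `IsRegular` of the subscheme `C`, available from the regular-pair data — not restated
here); nothing here proves X44c (O1–O7 remain), resolution in characteristic `p`, or any case of `CleanModels`.
-/

noncomputable section

set_option linter.dupNamespace false -- mandated namespace of this single-conjunct summit

open CategoryTheory AlgebraicGeometry TopologicalSpace IsLocalRing Opposite
open Literature.AlgebraicGeometry.Resolution Literature.AlgebraicGeometry.Motives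
open Scheme.IdealSheafData

namespace Summit.ResolutionOfSingularities.ResolutionOfSingularities.Theorems.RadicialJung.CleanModels

/-- **The strict transform along a chain stays in the non-locally-principal locus** of the pulled-back ideal sheaf (given the curve was,
and the base point lies in the closure of the rest of the curve). [folklore] -/
theorem IsPointChainAlong.forall_not_isLocallyPrincipalAt {X X' : Scheme.{0}} [IsLocallyNoetherian X] [IsLocallyNoetherian X']
    {σ : X' ⟶ X} {C₀ : Closeds X} {C : Closeds X'} {x : X'} {n : ℕ} (h : IsPointChainAlong σ C₀ C x n) (hX : Scheme.IsRegular X)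
    (hC₀reg : ∀ y ∈ (C₀ : Set X), ∃ c : Fin 2 → X.presheaf.stalk y, IsRsopPart c ∧ Ideal.span (Set.range c) = stalkIdeal (vanishingIdeal C₀) y)
    (hxC₀ : σ x ∈ (C₀ : Set X)) (hdim₀ : ringKrullDim (X.presheaf.stalk (σ x)) = 3) (hx₀cl : IsClosed ({σ x} : Set X))
    (h0 : σ x ∈ closure ((C₀ : Set X) \ {σ x})) (K : X.IdealSheafData) (hnp : ∀ y ∈ (C₀ : Set X), ¬ IsLocallyPrincipalAt K y) :
    ∀ y ∈ (C : Set X'), ¬ IsLocallyPrincipalAt (K.comap σ) y := by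
  have hsub : (C : Set X') \ {x} ⊆ (nonPrincipalLocus (K.comap σ) : Set X') := by
    rintro y ⟨hyC, hyx⟩
    have hne : σ y ≠ σ x := fun heq => hyx (h.eq_of_mem_of_eq hX hC₀reg hxC₀ hdim₀ y hyC heq)
    have hyC₀ : σ y ∈ (C₀ : Set X) := by
      have h1 : y ∈ (C : Set X') ∩ σ ⁻¹' {σ x}ᶜ := ⟨hyC, hne⟩
      rw [h.inter_preimage_compl hx₀cl] at h1
      exact h1.1
    obtain ⟨hiso, -⟩ := h.stalkIdeal_eq_map_of_ne hx₀cl y hne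
    haveI := hiso
    exact fun hprin => hnp _ hyC₀ (isLocallyPrincipalAt_of_comap_of_isIso_stalkMap σ hprin)
  intro y hyC
  by_cases hyx : y = x
  · subst hyx
    have hmem : y ∈ (nonPrincipalLocus (K.comap σ) : Set X') :=
      ((nonPrincipalLocus (K.comap σ)).isClosed.closure_subset_iff.mpr hsub) (h.mem_closure_sdiff h0)
    exact hmem
  · exact hsub ⟨hyC, hyx⟩

/-- **L7b-global, recorded as an extension of the clean-permissible Cossart–Piltant sequence.**  See the module docstring; `N` bounds the number
of bad points (induction). [cite: CossartPiltant2019, Prop. 4.4 (i)] [cite: CossartPiltant2008, Prop. 4.4 (proof, p. 10)] [cite: Piltant2013, §2 Axiom 4] -/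
theorem exists_isCleanRegularCentreBlowupSeq_forall_cleanPermissibleAt_of_ncard_le (p : ℕ) [hp : Fact p.Prime] (N : ℕ) :
    ∀ {S X : Scheme.{0}} [IsIntegral S] [IsIntegral X] [IsLocallyNoetherian X] {ρ : X ⟶ S} [IsDominant ρ] {J : S.IdealSheafData}
      {G₀ : S.functionField} [CharP S.functionField p] (_ : IsCleanRegularCentreBlowupSeq p ρ J G₀)
      (_ : ∀ s : S, CleanRegAt p (algebraMap (S.presheaf.stalk s) S.functionField) G₀)
      (_ : Scheme.IsRegular X) (_ : Scheme.IsQuasiExcellent X) {C₀ : Closeds X}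
      (_ : ∀ y ∈ (C₀ : Set X), ∃ c : Fin 2 → X.presheaf.stalk y, IsRsopPart c ∧ Ideal.span (Set.range c) = stalkIdeal (vanishingIdeal C₀) y)
      {η : X} (_ : (C₀ : Set X) = closure {η}) (_ : ∀ y ∈ (C₀ : Set X), y ≠ η → IsClosed ({y} : Set X))
      (_ : ∀ y ∈ (C₀ : Set X), y ≠ η → ringKrullDim (X.presheaf.stalk y) = 3)
      (_ : ∀ y ∈ (C₀ : Set X), ¬ IsLocallyPrincipalAt (J.comap ρ) y) (G : X.functionField) (_ : G = RatFn.functionFieldMap ρ G₀)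
      (_ : {y : X | y ∈ (C₀ : Set X) ∧ ¬ CleanPermissibleAt p (RatFn.toFunctionField y) G (stalkIdeal (vanishingIdeal C₀) y)}.Finite)
      (_ : {y : X | y ∈ (C₀ : Set X) ∧ ¬ CleanPermissibleAt p (RatFn.toFunctionField y) G (stalkIdeal (vanishingIdeal C₀) y)}.ncard ≤ N),
    ∃ (X' : Scheme.{0}) (_ : IsIntegral X') (_ : IsLocallyNoetherian X') (σ : X' ⟶ X) (_ : IsDominant σ) (C : Closeds X') (η' : X'),
      IsCleanRegularCentreBlowupSeq p (σ ≫ ρ) J G₀ ∧ IsProper σ ∧ Scheme.IsRegular X' ∧ Scheme.IsQuasiExcellent X' ∧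
      (∀ y ∈ (C : Set X'), ∃ c : Fin 2 → X'.presheaf.stalk y, IsRsopPart c ∧ Ideal.span (Set.range c) = stalkIdeal (vanishingIdeal C) y) ∧
      (C : Set X') = closure {η'} ∧ σ η' = η ∧
      (∀ y ∈ (C : Set X'), ¬ IsLocallyPrincipalAt ((J.comap ρ).comap σ) y) ∧
      ∀ y ∈ (C : Set X'), CleanPermissibleAt p (RatFn.toFunctionField y) (RatFn.functionFieldMap σ G) (stalkIdeal (vanishingIdeal C) y) := by
  induction N with
  | zero =>
    intro S X _ _ _ ρ _ J G₀ _ hρ hG₀ hX hE C₀ hC₀reg η hη hcl hdim3 hnp G hG hfin hN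
    have hgood : ∀ y ∈ (C₀ : Set X), CleanPermissibleAt p (RatFn.toFunctionField y) G (stalkIdeal (vanishingIdeal C₀) y) := by
      intro y hy
      by_contra hbad
      have h0 := (Set.ncard_eq_zero hfin).mp (Nat.le_zero.mp hN)
      have hmem : y ∈ {y : X | y ∈ (C₀ : Set X) ∧
          ¬ CleanPermissibleAt p (RatFn.toFunctionField y) G (stalkIdeal (vanishingIdeal C₀) y)} := ⟨hy, hbad⟩
      rw [h0] at hmem
      exact hmem
    refine ⟨X, inferInstance, inferInstance, 𝟙 X, inferInstance, C₀, η, by simpa using hρ, inferInstance, hX, hE, hC₀reg, hη, rfl, ?_, ?_⟩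
    · intro y hy; rw [Scheme.IdealSheafData.comap_id]; exact hnp y hy
    · intro y hy
      rw [RatFn.functionFieldMap_id, RingHom.id_apply]
      exact hgood y hy
  | succ N ih =>
    intro S X _ _ _ ρ _ J G₀ _ hρ hG₀ hX hE C₀ hC₀reg η hη hcl hdim3 hnp G hG hfin hN
    classical
    haveI : CharP X.functionField p := charP_of_injective_ringHom (RatFn.functionFieldMap ρ).injective p
    have hclean : ∀ x : X, CleanRegAt p (RatFn.toFunctionField x) G := by
      intro x; rw [hG]; exact hρ.cleanRegAt hp.out inferInstance hG₀ x
    have hηgood : CleanPermissibleAt p (RatFn.toFunctionField η) G (stalkIdeal (vanishingIdeal C₀) η) :=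
      cleanPermissibleAt_genericPoint_of_cleanRegAt p hη G (hclean η)
    by_cases hle : {y : X | y ∈ (C₀ : Set X) ∧
        ¬ CleanPermissibleAt p (RatFn.toFunctionField y) G (stalkIdeal (vanishingIdeal C₀) y)}.ncard ≤ N
    · exact ih hρ hG₀ hX hE hC₀reg hη hcl hdim3 hnp G hG hfin hle
    -- a bad point `x₀ ≠ η`
    have hne : {y : X | y ∈ (C₀ : Set X) ∧
        ¬ CleanPermissibleAt p (RatFn.toFunctionField y) G (stalkIdeal (vanishingIdeal C₀) y)}.Nonempty := by
      rw [Set.nonempty_iff_ne_empty]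
      intro h0
      apply hle
      rw [h0, Set.ncard_empty]; exact Nat.zero_le _
    obtain ⟨x₀, hx₀C, hx₀bad⟩ := hne
    have hx₀η : x₀ ≠ η := by rintro rfl; exact hx₀bad hηgood
    -- the descent step: one chain at `x₀`
    obtain ⟨X₁, hX₁i, hX₁n, σ₁, hσ₁d, C₁, x₁, n₁, hchain, hσx, hx₁cl, hx₁good, hfin₁, hlt⟩ :=
      exists_pointChain_good_ncard_bad_lt hX hE p hC₀reg hη hcl hdim3 G hfin hx₀C hx₀η hx₀bad (hclean x₀)
    subst hσx
    have hx₀cl : IsClosed ({σ₁ x₁} : Set X) := hcl _ hx₀C hx₀η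
    have hdim₀ : ringKrullDim (X.presheaf.stalk (σ₁ x₁)) = 3 := hdim3 _ hx₀C hx₀η
    have h0 : σ₁ x₁ ∈ closure ((C₀ : Set X) \ {σ₁ x₁}) := by
      have hsub : ({η} : Set X) ⊆ (C₀ : Set X) \ {σ₁ x₁} := by
        rintro z hz
        rw [Set.mem_singleton_iff] at hz
        subst hz
        exact ⟨by rw [hη]; exact subset_closure rfl, fun heq => hx₀η (Set.mem_singleton_iff.mp heq).symm⟩
      have h1 := closure_mono hsub
      rw [← hη] at h1
      exact h1 hx₀C
    obtain ⟨hX₁, hC₁reg, -, -⟩ := data_along_pointChain hchain hX hC₀reg hx₀C hdim₀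
    have hE₁ : Scheme.IsQuasiExcellent X₁ := hchain.isQuasiExcellent hE
    obtain ⟨η₁, hη₁C, hση₁, hη₁, hcl₁, hdim3₁, hoff⟩ := hchain.curve_data hX hC₀reg hη hcl hdim3 hx₀C hx₀η hx₁cl p G
    -- the chain extends the clean-permissible sequence, and the strict transform stays in the non-principal locus
    obtain ⟨_, _, hseq₁⟩ := hchain.isCleanRegularCentreBlowupSeq hp.out hρ hG₀ hX hC₀reg hnp hx₀C hdim₀ hx₀cl h0
    have hnp₁ : ∀ y ∈ (C₁ : Set X₁), ¬ IsLocallyPrincipalAt (J.comap (σ₁ ≫ ρ)) y := by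
      rw [Scheme.IdealSheafData.comap_comp]
      exact hchain.forall_not_isLocallyPrincipalAt hX hC₀reg hx₀C hdim₀ hx₀cl h0 (J.comap ρ) hnp
    have hG₁ : RatFn.functionFieldMap σ₁ G = RatFn.functionFieldMap (σ₁ ≫ ρ) G₀ := by
      rw [hG, RatFn.functionFieldMap_comp ρ σ₁, RingHom.comp_apply]
    have hN₁ : {y : X₁ | y ∈ (C₁ : Set X₁) ∧
        ¬ CleanPermissibleAt p (RatFn.toFunctionField y) (RatFn.functionFieldMap σ₁ G) (stalkIdeal (vanishingIdeal C₁) y)}.ncard ≤ N := by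
      omega
    -- induction
    obtain ⟨X₂, hX₂i, hX₂n, σ₂, hσ₂d, C₂, η₂, hseq₂, hprop₂, hX₂, hE₂, hC₂reg, hη₂, hση₂, hnp₂, hall₂⟩ :=
      ih hseq₁ hG₀ hX₁ hE₁ hC₁reg hη₁ hcl₁ hdim3₁ hnp₁ (RatFn.functionFieldMap σ₁ G) hG₁ hfin₁ hN₁
    haveI := hprop₂
    haveI : IsProper σ₁ := hchain.isProper
    refine ⟨X₂, hX₂i, hX₂n, σ₂ ≫ σ₁, inferInstance, C₂, η₂, by simpa only [Category.assoc] using hseq₂, inferInstance, hX₂, hE₂, hC₂reg, hη₂,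
      ?_, ?_, ?_⟩
    · rw [Scheme.Hom.comp_apply, hση₂, hση₁]
    · intro y hy
      have h1 : (J.comap ρ).comap (σ₂ ≫ σ₁) = (J.comap (σ₁ ≫ ρ)).comap σ₂ := by
        rw [Scheme.IdealSheafData.comap_comp, Scheme.IdealSheafData.comap_comp]
      rw [h1]; exact hnp₂ y hy
    · intro y hy
      rw [RatFn.functionFieldMap_comp σ₁ σ₂, RingHom.comp_apply]
      exact hall₂ y hy

/-- **L7b-global on the stages of `stub_cleanProp44`, recorded in its own predicate.**  `S` regular excellent Noetherian integral
(`char K(S) = p`), the line of `G₀` clean-regular everywhere, `ρ : X → S` a clean-permissible Cossart–Piltant sequence for `(J, G₀)` with `X`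
Noetherian, `C₀ = cl{η} ⊆ X` a one-dimensional regular curve (`dim 𝒪_η = 2`; other points closed, `dim 3`) inside the non-locally-principal locus
of `J𝒪_X`: then some `σ : X' → X` makes `σ ≫ ρ` again a clean-permissible Cossart–Piltant sequence for `(J, G₀)`, with `X'` Noetherian regular
quasi-excellent and the strict transform `C = cl{η'}` a regular curve in the non-locally-principal locus of `J𝒪_{X'}`, clean-permissible for the line
at EVERY point. [cite: CossartPiltant2019, Prop. 4.4 (i)] [cite: CossartPiltant2008, Prop. 4.4 (proof, p. 10)] [cite: Piltant2013, §2 Axiom 4] -/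
theorem exists_isCleanRegularCentreBlowupSeq_forall_cleanPermissibleAt_of_stage (p : ℕ) [hp : Fact p.Prime] {S : Scheme.{0}}
    [IsIntegral S] [IsNoetherian S] [CharP S.functionField p] (hS : Scheme.IsRegular S) (hE : Scheme.IsExcellent S) (G₀ : S.functionField)
    (hG₀ : ∀ s : S, CleanRegAt p (algebraMap (S.presheaf.stalk s) S.functionField) G₀) {J : S.IdealSheafData}
    {X : Scheme.{0}} {ρ : X ⟶ S} [IsIntegral X] [IsNoetherian X] [IsDominant ρ] (hρ : IsCleanRegularCentreBlowupSeq p ρ J G₀)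
    {C₀ : Closeds X}
    (hC₀reg : ∀ y ∈ (C₀ : Set X), ∃ c : Fin 2 → X.presheaf.stalk y,
      IsRsopPart c ∧ Ideal.span (Set.range c) = stalkIdeal (vanishingIdeal C₀) y)
    {η : X} (hη : (C₀ : Set X) = closure {η}) (hdimη : ringKrullDim (X.presheaf.stalk η) = 2)
    (hcl : ∀ y ∈ (C₀ : Set X), y ≠ η → IsClosed ({y} : Set X)) (hdim3 : ∀ y ∈ (C₀ : Set X), y ≠ η → ringKrullDim (X.presheaf.stalk y) = 3)
    (hnp : ∀ y ∈ (C₀ : Set X), ¬ IsLocallyPrincipalAt (J.comap ρ) y) :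
    ∃ (X' : Scheme.{0}) (_ : IsIntegral X') (_ : IsNoetherian X') (σ : X' ⟶ X) (_ : IsDominant σ) (C : Closeds X') (η' : X'),
      IsCleanRegularCentreBlowupSeq p (σ ≫ ρ) J G₀ ∧ IsProper σ ∧ Scheme.IsRegular X' ∧ Scheme.IsQuasiExcellent X' ∧
      (∀ y ∈ (C : Set X'), ∃ c : Fin 2 → X'.presheaf.stalk y, IsRsopPart c ∧ Ideal.span (Set.range c) = stalkIdeal (vanishingIdeal C) y) ∧
      (C : Set X') = closure {η'} ∧ σ η' = η ∧
      (∀ y ∈ (C : Set X'), ¬ IsLocallyPrincipalAt (J.comap (σ ≫ ρ)) y) ∧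
      ∀ y ∈ (C : Set X'), CleanPermissibleAt p (RatFn.toFunctionField y) (RatFn.functionFieldMap (σ ≫ ρ) G₀)
        (stalkIdeal (vanishingIdeal C) y) := by
  have hX : Scheme.IsRegular X := hρ.isRegularCentreBlowupSeq.isRegular hS
  have hXE : Scheme.IsQuasiExcellent X := hρ.isRegularCentreBlowupSeq.isQuasiExcellent hE
  haveI : CharP X.functionField p := charP_of_injective_ringHom (RatFn.functionFieldMap ρ).injective p
  have hclean : ∀ x : X, CleanRegAt p (RatFn.toFunctionField x) (RatFn.functionFieldMap ρ G₀) :=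
    fun x => hρ.cleanRegAt hp.out inferInstance hG₀ x
  have hfin := finite_setOf_not_cleanPermissibleAt_of_cleanRegAt_genericPoint hX hXE p hC₀reg hη hdimη hcl _ (hclean η)
  obtain ⟨X', h1, h2, σ, h3, C, η', hseq, hprop, hX', hE', hCreg, hη', hση', hnp', hall⟩ :=
    exists_isCleanRegularCentreBlowupSeq_forall_cleanPermissibleAt_of_ncard_le p _ hρ hG₀ hX hXE hC₀reg hη hcl hdim3 hnp
      (RatFn.functionFieldMap ρ G₀) rfl hfin le_rfl
  haveI := hprop
  haveI : CompactSpace X' := QuasiCompact.compactSpace_of_compactSpace σ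
  haveI : IsNoetherian X' := {}
  refine ⟨X', h1, inferInstance, σ, h3, C, η', hseq, hprop, hX', hE', hCreg, hη', hση', fun y hy => ?_, fun y hy => ?_⟩
  · rw [Scheme.IdealSheafData.comap_comp]; exact hnp' y hy
  · rw [RatFn.functionFieldMap_comp ρ σ, RingHom.comp_apply]; exact hall y hy

end Summit.ResolutionOfSingularities.ResolutionOfSingularities.Theorems.RadicialJung.CleanModels

end
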